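import Summits.BirchSwinnertonDyer.BirchSwinnertonDyer.Theorems.ClassRecordThreeEulerHalvesAtThreeCartanTransportSplitEichler
import Summits.BirchSwinnertonDyer.BirchSwinnertonDyer.Theorems.ClassRecordThreeEulerHalvesAtThreeCartanTransportConj
import Summits.BirchSwinnertonDyer.BirchSwinnertonDyer.Theorems.ClassRecordThreeEulerHalvesAtThreeCartanCoverTorusDocking
import HarnessLib

/-!
# Cartan transport, brick X3 — the split sheet at `q` is a Cartan datum of level `(D, M q²; C∖q)`; conjugacy of its level group

Helper file for the crux `EulerHalvesAtThree` of route `ClassRecordThree` (node served: residue crux `EulerHalvesAtThreeResidualUpperBound`,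
line `cartan`, item NUM := `CartanOnePlaceDegreeLawAtThree`, skeleton `Lines/lattice` v2, transport half of the mixed input (P+T)), lane (α′).
For `X : CartanLevelCurveData D M C`, `q ∈ C` and a reduction datum `R : CoverReduction X q` of the cover order `O₀' = X.O + n_q X.O₀`:
* §1 `forall_of_mem_coverOrder` ∕ `mem_coverOrder_of_forall` — `O₀' = {x ∈ X.O₀ : x ∈ X.O + p X.O₀ for every p ∈ C∖q}`;
* §2 `relIndex_coverOrder` — `[X.O₀ : O₀'] = ∏_{p ∈ C∖q} p²` (brick H2a: the indices `[X.O₀ : X.O + p X.O₀] = p²` are coprime);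
* §3 `exists_gl_pos_conj_splitLevel` — **the split sheet.** `O_s := {x ∈ O₀' : R.red x diagonal}` together with the split hull
  `E_s` (brick X2b), `X.ι` and a Dirichlet domain (brick H0) is a `CartanLevelCurveData D (M q²) (C∖q)` INSIDE `X.B` whose level group is
  `R.levelOf T` for the diagonal torus `T ≤ GL₂(𝔽_q)`; hence (brick A2, Eichler's type number one) for EVERY presentation
  `X' : CartanLevelCurveData D (M q²) (C∖q)` there is `g ∈ GL₂⁺(ℝ)` with `ι'(X'.O) = g⁻¹ ι(O_s) g` and `X'.Gamma = g⁻¹ (R.levelOf T) g`.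
This is the transport input of (P+T): the class-minimal parametrisation `Q'` on `X'` moves to a cusp form on the split-Cartan level
`R.levelOf T` of the cover (`R.dockTorus T`). No definition is introduced (the datum is assembled inside the proof); nothing is proved
about NUM, (F2b♮) or any summit statement. [cite: Voight2021, 23.2.3, Def. 23.4.1, 23.4.3, Thm. 28.5.3] [cite: KohenPacetti2016, §2 and Rem. 3.8
(arXiv:1403.7801v3 pp. 7–8, 15)] [cite: VignerasLNM800, Ch. III §5 and Ch. IV §1]
-/

set_option linter.dupNamespace false
set_option autoImplicit false

open scoped MatrixGroups

namespace Summit.BirchSwinnertonDyer.BirchSwinnertonDyer.Theorems.CartanTransport.Split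

open Literature.NumberTheory.Automorphic
open Summit.BirchSwinnertonDyer.BirchSwinnertonDyer.Theorems.CartanDegree
open Summit.BirchSwinnertonDyer.BirchSwinnertonDyer.Theorems.CartanTransport
open Summit.BirchSwinnertonDyer.BirchSwinnertonDyer.Theorems.CartanCover

variable {D M : ℕ} {C : Finset ℕ}

/-! ## §1 The cover order by congruences away from `q` -/

/-- PROVED — an element of `O₀' = X.O + n_q X.O₀` lies in `X.O + p X.O₀` for every `p ∈ C`, `p ≠ q`. [folklore] -/
theorem forall_of_mem_coverOrder (X : CartanLevelCurveData D M C) {q : ℕ} {x : X.B} (hx : x ∈ coverOrder X q) :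
    ∀ p ∈ C, p ≠ q → ∃ a ∈ X.O, ∃ y ∈ X.O₀, x - a = (p : ℤ) • y := by
  classical
  intro p hp hpq
  obtain ⟨a, ha, w, hw, rfl⟩ := (mem_coverOrder_iff X q).mp hx
  have hpe : p ∈ C.erase q := Finset.mem_erase.mpr ⟨hpq, hp⟩
  have hn : (coverIndex C q : ℕ) = p * ∏ r ∈ (C.erase q).erase p, r := by
    show (∏ r ∈ C.erase q, r) = _
    exact (Finset.mul_prod_erase (C.erase q) (fun r => r) hpe).symm
  refine ⟨a, ha, ((∏ r ∈ (C.erase q).erase p, r : ℕ) : ℤ) • w, X.O₀.smul_mem _ hw, ?_⟩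
  rw [add_sub_cancel_left, hn, Nat.cast_mul, mul_smul]

/-- PROVED — **`O₀' = X.O₀ ∩ ⋂_{p ∈ C∖q} (X.O + p X.O₀)`**: an element of the hull congruent to `X.O` modulo `p X.O₀` for every
`p ∈ C∖q` lies in the cover order (residue pinning of `X.O`, bricks H1/H2b, and brick R §2). [folklore] -/
theorem mem_coverOrder_of_forall (X : CartanLevelCurveData D M C) {q : ℕ} (hq : q ∈ C) {x : X.B} (hx : x ∈ X.O₀)
    (h : ∀ p ∈ C, p ≠ q → ∃ a ∈ X.O, ∃ y ∈ X.O₀, x - a = (p : ℤ) • y) : x ∈ coverOrder X q := by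
  classical
  have hψex : ∀ p : ℕ, ∃ ψ : X.B → Matrix (Fin 2) (Fin 2) (ZMod p), ∀ hp : p ∈ C,
      haveI : Fact p.Prime := ⟨(X.coprime p hp).1⟩; IsMatrixResidueMap X.O₀ p ψ := by
    intro p
    by_cases hp : p ∈ C
    · haveI : Fact p.Prime := ⟨(X.coprime p hp).1⟩
      obtain ⟨ψ, hψ⟩ := Residue.exists_isMatrixResidueMap_of_mem X hp
      exact ⟨ψ, fun _ => hψ⟩
    · exact ⟨fun _ => 0, fun h => (hp h).elim⟩
  choose ψ hψ using hψex
  have hηex : ∀ p : ℕ, ∃ η : Matrix (Fin 2) (Fin 2) (ZMod p), ∀ hp : p ∈ C, ¬ HasRatEigenvalue η ∧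
      ∀ y ∈ X.O₀, ((∃ a ∈ X.O, ∃ z ∈ X.O₀, y - a = (p : ℤ) • z) ↔
        ∃ c : ZMod p × ZMod p, ψ p y = c.1 • (1 : Matrix (Fin 2) (Fin 2) (ZMod p)) + c.2 • η) := by
    intro p
    by_cases hp : p ∈ C
    · haveI : Fact p.Prime := ⟨(X.coprime p hp).1⟩
      obtain ⟨η, hη, hT⟩ := ResiduePinning.exists_eta X hp (hψ p hp)
      exact ⟨η, fun _ => ⟨hη, fun y hy => ResiduePinning.mem_level_iff_exists_lin X (hψ p hp) hT hy⟩⟩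
    · exact ⟨0, fun h => (hp h).elim⟩
  choose η hη using hηex
  have hpin : ∀ x : X.B, x ∈ X.O ↔ x ∈ X.O₀ ∧ ∀ p ∈ C, ∃ c : ZMod p × ZMod p,
      ψ p x = c.1 • (1 : Matrix (Fin 2) (Fin 2) (ZMod p)) + c.2 • η p :=
    ResiduePinning.mem_O_iff_residues X ψ η fun p hp y hy => (hη p hp).2 y hy
  exact Cover.mem_coverOrder_of_residues X ψ hψ η hpin hq hx fun p hp hpq => ((hη p hp).2 x hx).mp (h p hp hpq)

/-! ## §2 The index of the cover order -/

/-- PROVED — **`[X.O₀ : O₀'] = ∏_{p ∈ C∖q} p²`** (`O₀' = X.O₀ ∩ ⋂_{p ∈ C∖q} (X.O + p X.O₀)` by §1; the indices `[X.O₀ : X.O + p X.O₀] = p²`,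
brick H2a, are pairwise coprime). [folklore] -/
theorem relIndex_coverOrder (X : CartanLevelCurveData D M C) {q : ℕ} (hq : q ∈ C) :
    (coverOrder X q).toAddSubgroup.relIndex X.O₀.toAddSubgroup = ∏ p ∈ C.erase q, p ^ 2 := by
  classical
  obtain ⟨K, hK⟩ : ∃ K : ℕ → AddSubgroup X.B, ∀ p, K p = X.O.toAddSubgroup ⊔ X.O₀.toAddSubgroup.map (zsmulAddGroupHom (p : ℤ)) :=
    ⟨_, fun _ => rfl⟩
  have hprime : ∀ p ∈ C, p.Prime := fun p hp => (X.coprime p hp).1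
  have hKi : ∀ p ∈ C, (K p).relIndex X.O₀.toAddSubgroup = p ^ 2 := fun p hp => by
    rw [hK]; exact ResidueIndex.relIndex_level_eq X hp
  have hcov : (coverOrder X q).toAddSubgroup = X.O₀.toAddSubgroup ⊓ ⨅ p ∈ C.erase q, K p := by
    apply le_antisymm
    · refine le_inf (fun x hx => coverOrder_le X q hx) (le_iInf₂ fun p hp x hx => ?_)
      obtain ⟨hpq, hpC⟩ := Finset.mem_erase.mp hp
      obtain ⟨a, ha, y, hy, hxy⟩ := forall_of_mem_coverOrder X hx p hpC hpq
      rw [hK]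
      refine AddSubgroup.mem_sup.mpr ⟨a, ha, (p : ℤ) • y, AddSubgroup.mem_map.mpr ⟨y, hy, zsmulAddGroupHom_apply _ _⟩, ?_⟩
      rw [← hxy]; abel
    · intro x hx
      obtain ⟨hx0, hx⟩ := AddSubgroup.mem_inf.mp hx
      refine mem_coverOrder_of_forall X hq hx0 fun p hp hpq => ?_
      have hxp := AddSubgroup.mem_iInf.mp (AddSubgroup.mem_iInf.mp hx p) (Finset.mem_erase.mpr ⟨hpq, hp⟩)
      rw [hK] at hxp
      obtain ⟨a, ha, z, hz, haz⟩ := AddSubgroup.mem_sup.mp hxp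
      obtain ⟨y, hy, rfl⟩ := AddSubgroup.mem_map.mp hz
      exact ⟨a, ha, y, hy, by rw [← haz, zsmulAddGroupHom_apply]; abel⟩
  have hne : ∀ p ∈ C.erase q, (K p).relIndex X.O₀.toAddSubgroup ≠ 0 := fun p hp => by
    rw [hKi p (Finset.mem_of_mem_erase hp)]
    exact pow_ne_zero _ (hprime p (Finset.mem_of_mem_erase hp)).ne_zero
  have hcop : ∀ i ∈ C.erase q, ∀ j ∈ C.erase q, i ≠ j →
      Nat.Coprime ((K i).relIndex X.O₀.toAddSubgroup) ((K j).relIndex X.O₀.toAddSubgroup) := fun i hi j hj hij => by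
    rw [hKi i (Finset.mem_of_mem_erase hi), hKi j (Finset.mem_of_mem_erase hj)]
    exact Nat.Coprime.pow _ _ ((Nat.coprime_primes (hprime i (Finset.mem_of_mem_erase hi))
      (hprime j (Finset.mem_of_mem_erase hj))).mpr hij)
  rw [hcov, AddSubgroup.inf_relIndex_left, ResidueIndex.relIndex_iInf_eq_prod K _ (C.erase q) hne hcop]
  exact Finset.prod_congr rfl fun p hp => hKi p (Finset.mem_of_mem_erase hp)

/-! ## §3 The split sheet -/

/-- PROVED — **the split sheet at `q` and the conjugacy of its level.** For `q ∈ C`, a reduction datum `R` of the cover order, the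
diagonal torus `T ≤ GL₂(𝔽_q)` and ANY presentation `X'` of level `(D, M q²; C∖q)` there is `g ∈ GL₂⁺(ℝ)` with
`ι'(X'.O) = g⁻¹ · ι(O_s) · g`, `O_s = {y ∈ O₀' : R.red y diagonal}`, and `X'.Gamma = g⁻¹ (R.levelOf T) g`: the lattice `O_s` with
the split hull `E_s` (brick X2b) is a `CartanLevelCurveData D (M q²) (C∖q)` inside `X.B` (index §2 + Bezout, saturation §1, division
rings mod `p ∈ C∖q` from those of `X.O` corrected at `q`, Dirichlet domain brick H0) with level group `R.levelOf T`, and brick A2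
(Eichler: type number one + norm-one transport) conjugates any two data of the same level inside `GL₂⁺(ℝ)`.
[cite: Voight2021, 23.2.3, Def. 23.4.1, 23.4.3, Thm. 28.5.3] [cite: KohenPacetti2016, §2 and Rem. 3.8 (arXiv:1403.7801v3 pp. 7–8, 15)] -/
theorem exists_gl_pos_conj_splitLevel (X : CartanLevelCurveData D M C) {q : ℕ} [Fact q.Prime] (hq : q ∈ C) (R : CoverReduction X q)
    (T : Subgroup (GL (Fin 2) (ZMod q)))
    (hT : ∀ t : GL (Fin 2) (ZMod q), t ∈ T ↔
      (t : Matrix (Fin 2) (Fin 2) (ZMod q)) 1 0 = 0 ∧ (t : Matrix (Fin 2) (Fin 2) (ZMod q)) 0 1 = 0)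
    (X' : CartanLevelCurveData D (M * q ^ 2) (C.erase q)) :
    ∃ g : GL (Fin 2) ℝ, 0 < (Matrix.GeneralLinearGroup.det g).val ∧
      (∀ m : Matrix (Fin 2) (Fin 2) ℝ, (∃ x ∈ X'.O, X'.ι x = m) ↔
        ∃ y : X.B, (∃ hy : y ∈ coverOrder X q, R.red ⟨y, hy⟩ 1 0 = 0 ∧ R.red ⟨y, hy⟩ 0 1 = 0) ∧
          X.ι y = (g : Matrix (Fin 2) (Fin 2) ℝ) * m * ((g⁻¹ : GL (Fin 2) ℝ) : Matrix (Fin 2) (Fin 2) ℝ)) ∧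
      (∀ γ : GL (Fin 2) ℝ, γ ∈ X'.Gamma ↔ g * γ * g⁻¹ ∈ R.levelOf T) := by
  classical
  have hqP : q.Prime := Fact.out
  have hprime : ∀ p ∈ C, p.Prime := fun p hp => (X.coprime p hp).1
  have hO₀ := X.isEichlerOrder.isOrder
  -- the residue map of the hull compatible with `R.red` (brick X1) and the split hull (brick X2b)
  obtain ⟨ψ, hψ, hcompat⟩ := exists_residueMap_of_coverReduction X hq R
  obtain ⟨E, hEmem, hE⟩ := exists_splitHull X hψ
  have hEO₀ : E ≤ X.O₀ := fun x hx => ((hEmem x).mp hx).1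
  -- the split order `O_s = O₀' ∩ E_s`
  obtain ⟨Os, hOsdef⟩ : ∃ Os : Submodule ℤ X.B, Os = coverOrder X q ⊓ E := ⟨_, rfl⟩
  have hOsmem' : ∀ y, y ∈ Os ↔ y ∈ coverOrder X q ∧ y ∈ E := fun y => by rw [hOsdef, Submodule.mem_inf]
  have hOsmem : ∀ y, y ∈ Os ↔ ∃ hy : y ∈ coverOrder X q, R.red ⟨y, hy⟩ 1 0 = 0 ∧ R.red ⟨y, hy⟩ 0 1 = 0 := by
    intro y
    rw [hOsmem', hEmem]
    constructor
    · rintro ⟨hy, -, h10, h01⟩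
      exact ⟨hy, by rw [← hcompat y hy]; exact ⟨h10, h01⟩⟩
    · rintro ⟨hy, h10, h01⟩
      exact ⟨hy, coverOrder_le X q hy, by rw [hcompat y hy]; exact ⟨h10, h01⟩⟩
  have hOs : Brandt.IsOrder X.B Os := by
    rw [hOsdef]
    exact isZOrder_iff_isOrder.mp
      ((isZOrder_iff_isOrder.mpr (isOrder_coverOrder X q)).inf (isZOrder_iff_isOrder.mpr hE.isOrder))
  -- arithmetic helpers
  have hdiag_mul : ∀ A B : Matrix (Fin 2) (Fin 2) (ZMod q), A 1 0 = 0 → A 0 1 = 0 → B 1 0 = 0 → B 0 1 = 0 →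
      (A * B) 1 0 = 0 ∧ (A * B) 0 1 = 0 := by
    intro A B hA hA' hB hB'
    simp [Matrix.mul_apply, Fin.sum_univ_two, hA, hA', hB, hB']
  -- (coprime)
  have hcopr : ∀ p ∈ C.erase q, p.Prime ∧ ¬ p ∣ D * (M * q ^ 2) := by
    intro p hp
    obtain ⟨hpq, hpC⟩ := Finset.mem_erase.mp hp
    refine ⟨hprime p hpC, fun hdvd => ?_⟩
    rw [← mul_assoc] at hdvd
    rcases (Nat.Prime.dvd_mul (hprime p hpC)).mp hdvd with h | h
    · exact (X.coprime p hpC).2 h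
    · exact hpq ((Nat.prime_dvd_prime_iff_eq (hprime p hpC) hqP).mp ((hprime p hpC).dvd_of_dvd_pow h))
  -- (smul_mem)
  have hsmul : ∀ x ∈ E, ((coverIndex C q : ℕ) : ℤ) • x ∈ Os := fun x hx =>
    (hOsmem' _).mpr ⟨smul_mem_coverOrder X q (hEO₀ hx), E.smul_mem _ hx⟩
  -- (relIndex) `[E_s : O_s] = [X.O₀ : O₀']` as `O₀' + E_s = X.O₀` (`E_s ⊇ q X.O₀`, `O₀' ⊇ n_q X.O₀`, Bezout)
  have hqE : ∀ y ∈ X.O₀, ((q : ℕ) : ℤ) • y ∈ E := fun y hy =>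
    (hEmem _).mpr ⟨X.O₀.smul_mem _ hy, by rw [hψ.map_smul_eq_zero hy]; exact ⟨rfl, rfl⟩⟩
  have hsup : (coverOrder X q).toAddSubgroup ⊔ E.toAddSubgroup = X.O₀.toAddSubgroup := by
    apply le_antisymm (sup_le (fun x hx => coverOrder_le X q hx) (fun x hx => hEO₀ hx))
    intro y hy
    obtain ⟨a, b, hab⟩ := exists_bezout_of_not_dvd hqP
      (fun h => Cover.natCast_coverIndex_ne_zero X hq ((ZMod.natCast_eq_zero_iff _ _).mpr h))
    have e : y = (a * ((coverIndex C q : ℕ) : ℤ)) • y + (b * ((q : ℕ) : ℤ)) • y := by rw [← add_smul, hab, one_smul]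
    rw [e, mul_smul, mul_smul]
    exact AddSubgroup.add_mem_sup ((coverOrder X q).smul_mem a (smul_mem_coverOrder X q hy)) (E.smul_mem b (hqE y hy))
  have hidx : Os.toAddSubgroup.relIndex E.toAddSubgroup = ∏ p ∈ C.erase q, p ^ 2 := by
    have e : Os.toAddSubgroup = (coverOrder X q).toAddSubgroup ⊓ E.toAddSubgroup := AddSubgroup.ext fun y => hOsmem' y
    rw [e, AddSubgroup.inf_relIndex_right, ← AddSubgroup.relIndex_sup_left, hsup, relIndex_coverOrder X hq]
  -- (saturated)
  have hsat : ∀ x ∈ E, (∀ p ∈ C.erase q, ∃ a ∈ Os, ∃ y ∈ E, x - a = (p : ℤ) • y) → x ∈ Os := by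
    intro x hx h
    refine (hOsmem' _).mpr ⟨mem_coverOrder_of_forall X hq (hEO₀ hx) fun p hpC hpq => ?_, hx⟩
    have hpe : p ∈ C.erase q := Finset.mem_erase.mpr ⟨hpq, hpC⟩
    obtain ⟨a, ha, y, hy, hxy⟩ := h p hpe
    obtain ⟨a', ha', w, hw, haw⟩ := (mem_coverOrder_iff X q).mp ((hOsmem' _).mp ha).1
    have hn : (coverIndex C q : ℕ) = p * ∏ r ∈ (C.erase q).erase p, r := by
      show (∏ r ∈ C.erase q, r) = _
      exact (Finset.mul_prod_erase (C.erase q) (fun r => r) hpe).symm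
    refine ⟨a', ha', y + ((∏ r ∈ (C.erase q).erase p, r : ℕ) : ℤ) • w, X.O₀.add_mem (hEO₀ hy) (X.O₀.smul_mem _ hw), ?_⟩
    have e : x - a' = (x - a) + ((coverIndex C q : ℕ) : ℤ) • w := by rw [haw]; abel
    rw [e, hxy, hn, Nat.cast_mul, mul_smul, ← smul_add]
  -- (isDivisionRing_mod) from `X.isDivisionRing_mod`, correcting the inverse at `q` to a diagonal residue
  have hdivmod : ∀ p ∈ C.erase q, ∀ x ∈ Os, (¬ ∃ y ∈ E, x = (p : ℤ) • y) → ∃ z ∈ Os, ∃ y ∈ E, x * z - 1 = (p : ℤ) • y := by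
    intro p hpe x hx hnot
    obtain ⟨hpq, hpC⟩ := Finset.mem_erase.mp hpe
    have hp := hprime p hpC
    have hqp : ¬ q ∣ p := fun h => hpq ((Nat.prime_dvd_prime_iff_eq hqP hp).mp h).symm
    have hp0 : ((p : ℕ) : ZMod q) ≠ 0 := fun h => hqp ((ZMod.natCast_eq_zero_iff p q).mp h)
    have hpdiv : ∀ c : ZMod q, ((p : ℕ) : ℤ) • c = 0 → c = 0 := by
      intro c h
      rw [zsmul_eq_mul, Int.cast_natCast] at h
      rcases mul_eq_zero.mp h with h | h
      · exact absurd h hp0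
      · exact h
    have hEdiv : ∀ y ∈ X.O₀, ((p : ℕ) : ℤ) • y ∈ E → y ∈ E := by
      intro y hy hpy
      obtain ⟨-, h10, h01⟩ := (hEmem _).mp hpy
      rw [hψ.map_zsmul hy, Matrix.smul_apply] at h10 h01
      exact (hEmem _).mpr ⟨hy, hpdiv _ h10, hpdiv _ h01⟩
    obtain ⟨hxc, hxE⟩ := (hOsmem' _).mp hx
    have hxO : x ∈ X.O₀ := hEO₀ hxE
    obtain ⟨a, ha, w, hw, hxaw⟩ := (mem_coverOrder_iff X q).mp hxc
    have hn : (coverIndex C q : ℕ) = p * ∏ r ∈ (C.erase q).erase p, r := by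
      show (∏ r ∈ C.erase q, r) = _
      exact (Finset.mul_prod_erase (C.erase q) (fun r => r) hpe).symm
    obtain ⟨n₂, hn₂⟩ : ∃ n₂ : ℕ, n₂ = ∏ r ∈ (C.erase q).erase p, r := ⟨_, rfl⟩
    rw [← hn₂] at hn
    -- `a ∉ p X.O₀`
    have hna : ¬ ∃ y ∈ X.O₀, a = (p : ℤ) • y := by
      rintro ⟨y₀, hy₀, rfl⟩
      have e : x = ((p : ℕ) : ℤ) • (y₀ + ((n₂ : ℕ) : ℤ) • w) := by rw [hxaw, hn, Nat.cast_mul, mul_smul, smul_add]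
      exact hnot ⟨y₀ + ((n₂ : ℕ) : ℤ) • w, hEdiv _ (X.O₀.add_mem hy₀ (X.O₀.smul_mem _ hw)) (e ▸ hxE), e⟩
    obtain ⟨z', hz', y', hy', hazy⟩ := X.isDivisionRing_mod p hpC a ha hna
    have hz'O : z' ∈ X.O₀ := X.le hz'
    -- correct `z'` at `q`
    obtain ⟨t, ht⟩ := R.red_surjective (((p : ℕ) : ZMod q)⁻¹ • (Matrix.diagonal (fun i => ψ z' i i) - ψ z'))
    have htc : (t : X.B) ∈ coverOrder X q := t.2
    have htO : (t : X.B) ∈ X.O₀ := coverOrder_le X q htc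
    have hψt : ψ t = ((p : ℕ) : ZMod q)⁻¹ • (Matrix.diagonal (fun i => ψ z' i i) - ψ z') := by
      rw [hcompat _ htc]; exact ht
    obtain ⟨z, hz⟩ : ∃ z : X.B, z = z' + ((p : ℕ) : ℤ) • (t : X.B) := ⟨_, rfl⟩
    have hzc : z ∈ coverOrder X q := by
      rw [hz]; exact (coverOrder X q).add_mem (le_coverOrder X q hz') ((coverOrder X q).smul_mem _ htc)
    have hzO : z ∈ X.O₀ := coverOrder_le X q hzc
    have hψz : ψ z = Matrix.diagonal (fun i => ψ z' i i) := by
      rw [hz, hψ.map_add _ hz'O _ (X.O₀.smul_mem _ htO), hψ.map_zsmul htO, hψt, ← Int.cast_smul_eq_zsmul (ZMod q),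
        Int.cast_natCast, smul_smul, mul_inv_cancel₀ hp0, one_smul]
      abel
    have hzE : z ∈ E := (hEmem z).mpr ⟨hzO, by rw [hψz, Matrix.diagonal_apply_ne _ (by decide)],
      by rw [hψz, Matrix.diagonal_apply_ne _ (by decide)]⟩
    have hzOs : z ∈ Os := (hOsmem' _).mpr ⟨hzc, hzE⟩
    -- `x z - 1 = p • y''`
    obtain ⟨y'', hy''⟩ : ∃ y'' : X.B, y'' = y' + ((n₂ : ℕ) : ℤ) • (w * z') + x * (t : X.B) := ⟨_, rfl⟩
    have hy''O : y'' ∈ X.O₀ := by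
      rw [hy'']
      exact X.O₀.add_mem (X.O₀.add_mem hy' (X.O₀.smul_mem _ (hO₀.mul_mem w hw z' hz'O))) (hO₀.mul_mem x hxO _ htO)
    have hxz : x * z - 1 = ((p : ℕ) : ℤ) • y'' := by
      have e1 : x * z' = a * z' + ((p : ℕ) : ℤ) • (((n₂ : ℕ) : ℤ) • (w * z')) := by
        rw [hxaw, hn, Nat.cast_mul, add_mul, mul_smul, smul_mul_assoc, smul_mul_assoc]
      have e : x * z - 1 = (a * z' - 1) + ((p : ℕ) : ℤ) • (((n₂ : ℕ) : ℤ) • (w * z') + x * (t : X.B)) := by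
        rw [hz, mul_add, mul_smul_comm, e1, smul_add]
        abel
      rw [e, hazy, hy'', ← smul_add, add_assoc]
    have hψxz : ψ (x * z - 1) 1 0 = 0 ∧ ψ (x * z - 1) 0 1 = 0 := by
      obtain ⟨-, hx10, hx01⟩ := (hEmem x).mp hxE
      obtain ⟨-, hz10, hz01⟩ := (hEmem z).mp hzE
      rw [hψ.map_sub (hO₀.mul_mem x hxO z hzO) hO₀.one_mem, hψ.map_mul _ hxO _ hzO, hψ.map_one, Matrix.sub_apply,
        Matrix.sub_apply, Matrix.one_apply_ne (by decide), Matrix.one_apply_ne (by decide), sub_zero, sub_zero]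
      exact hdiag_mul _ _ hx10 hx01 hz10 hz01
    have hy''E : y'' ∈ E := by
      refine hEdiv _ hy''O ?_
      rw [← hxz]
      exact (hEmem _).mpr ⟨X.O₀.sub_mem (hO₀.mul_mem x hxO z hzO) hO₀.one_mem, hψxz.1, hψxz.2⟩
    exact ⟨z, hzOs, y'', hy''E, hxz⟩
  -- the datum
  obtain ⟨fd, hfd⟩ := Hull.exists_isHypFundamentalDomain_normOneUnits X.ι hOs
  let Xs : CartanLevelCurveData D (M * q ^ 2) (C.erase q) :=
    { B := X.B, squarefree := X.squarefree, ramifiedPlaces_eq := X.ramifiedPlaces_eq, coprime := hcopr, O₀ := E,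
      isEichlerOrder := hE, O := Os, isOrder := hOs, le := fun y hy => ((hOsmem' y).mp hy).2, smul_mem := hsmul,
      relIndex_eq := hidx, saturated := hsat, isDivisionRing_mod := hdivmod, ι := X.ι, ι_injective := X.ι_injective, fd := fd,
      isFundamentalDomain_fd := hfd }
  have hXsG : Xs.Gamma = normOneUnits X.ι hOs := rfl
  -- its level group is `R.levelOf T`
  have hGamma : ∀ γ : GL (Fin 2) ℝ, γ ∈ Xs.Gamma ↔ γ ∈ R.levelOf T := by
    intro γ
    rw [hXsG, CoverReduction.mem_levelOf_iff, mem_normOneUnits_iff]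
    constructor
    · rintro ⟨⟨x, hx, hxγ⟩, ⟨y, hy, hyγ⟩, hdet⟩
      obtain ⟨hxc, hx10, hx01⟩ := (hOsmem x).mp hx
      obtain ⟨hyc, -, -⟩ := (hOsmem y).mp hy
      have hcov : γ ∈ coverUnits X q := ⟨⟨x, hxc, hxγ⟩, ⟨y, hyc, hyγ⟩, hdet⟩
      refine ⟨hcov, (hT _).mpr ?_⟩
      rw [CoverReduction.coe_redHom, unitLift_eq_of_ι_eq ⟨γ, hcov⟩ hxc hxγ]
      exact ⟨hx10, hx01⟩
    · rintro ⟨hcov, hTm⟩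
      have hcov' := hcov
      rw [coverUnits, mem_normOneUnits_iff] at hcov'
      obtain ⟨⟨x, hxc, hxγ⟩, ⟨y, hyc, hyγ⟩, hdet⟩ := hcov'
      have h1 := (hT _).mp hTm
      have h2 := (hT _).mp (T.inv_mem hTm)
      rw [← map_inv, CoverReduction.coe_redHom,
        unitLift_eq_of_ι_eq (⟨γ, hcov⟩⁻¹ : coverUnits X q) hyc (by rw [Subgroup.coe_inv]; exact hyγ)] at h2
      rw [CoverReduction.coe_redHom, unitLift_eq_of_ι_eq ⟨γ, hcov⟩ hxc hxγ] at h1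
      exact ⟨⟨x, (hOsmem x).mpr ⟨hxc, h1⟩, hxγ⟩, ⟨y, (hOsmem y).mpr ⟨hyc, h2⟩, hyγ⟩, hdet⟩
  -- brick A2: any two Cartan data of level `(D, M q²; C∖q)` are `GL₂⁺(ℝ)`-conjugate
  obtain ⟨g, hdet, hconj⟩ := Conj.exists_gl_pos_conj_cartan X' Xs
  refine ⟨g, hdet, fun m => ?_, fun γ => ?_⟩
  · rw [hconj m]
    show (∃ y ∈ Os, X.ι y = _) ↔ _
    constructor
    · rintro ⟨y, hy, hyι⟩; exact ⟨y, (hOsmem y).mp hy, hyι⟩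
    · rintro ⟨y, hy, hyι⟩; exact ⟨y, (hOsmem y).mpr hy, hyι⟩
  · rw [← hGamma, hXsG]
    show γ ∈ normOneUnits X'.ι X'.isOrder ↔ g * γ * g⁻¹ ∈ normOneUnits X.ι hOs
    rw [mem_normOneUnits_iff, mem_normOneUnits_iff]
    have hd : Matrix.GeneralLinearGroup.det (g * γ * g⁻¹) = Matrix.GeneralLinearGroup.det γ := by
      rw [map_mul, map_mul, map_inv, mul_inv_eq_iff_eq_mul, mul_comm]
    have hinv : (g * γ * g⁻¹)⁻¹ = g * γ⁻¹ * g⁻¹ := by group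
    rw [hd, hinv]
    simp only [Units.val_mul]
    exact and_congr (hconj _) (and_congr (hconj _) Iff.rfl)

end Summit.BirchSwinnertonDyer.BirchSwinnertonDyer.Theorems.CartanTransport.Split
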